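import Mathlib
import Literature.MathematicalPhysics.QuantumFieldTheory.StrongCouplingTorusSystem
import Literature.MathematicalPhysics.QuantumFieldTheory.U1DualRepresentation
import Literature.MathematicalPhysics.QuantumFieldTheory.CircleHaarAngle
import Summits.Ventures.LatticeQCDFlow.Exactness.CompactHaar
import Summits.Ventures.LatticeQCDFlow.Scaling.LatticeEntropyU1

/-!
# LatticeQCDFlow / Scaling — `U(1)` Haar tools on the torus plaquette system: one-bond
# translations, peeling a plaquette through a private bond, circle moments

HONEST FRAMING: exact (Metropolis-corrected) sampling algorithms for lattice gauge theory;
figures of merit are autocorrelation/cost numbers at stated couplings and volumes; no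
continuum-physics claim.

Venture `LatticeQCDFlow` (cell pub-lqcd), topic `Scaling`, FANOUT row 30 (lean-1) — OUR WORK, the
probabilistic toolkit for the leading-coefficient identity (LC) of theory2 item 120
(HOME/lean/theory2/LANDING.md §32) for `G = U(1) = Circle`.  The torus plaquette system
`torusSystem ρ L` (`StrongCouplingTorusSystem`) lives on the infinite Haar product
`ν = zdHaar d Circle`, which is a Haar probability measure on the compact abelian configuration
group (`U1DualRepresentation`); everything below is translation invariance of `ν` by ONE bond
variable plus Fubini.

* `holT L q U`, `cosT L q U` — the torus plaquette holonomy of the label `q` read through the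
  section `torusSigma`, and its real part (the `U(1)` plaquette "cosine");
  `torusCost_u1Rep_eq` — the system cost is `1 − cosT`.
* `torusSigma_mulSingle`, `holT_mulSingle_of_forall_ne`, `holT_mulSingle_eq_mul`,
  `holT_mulSingle_eq_inv_mul` — multiplying the bond variable `e` by `z` multiplies `U_q` by `z`,
  `z⁻¹` or `1` according as `e` is a positively oriented bond of `q`, a negatively oriented one, or
  none (abelian group).
* `integral_mulSingle_mul_eq` — `∫ F(δ_e(z)·U) dν = ∫ F dν` (left invariance of the Haar product).
* **`integral_mul_comp_holT_eq_mul_integral`** — PEELING: if `G` is unchanged by translating the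
  bond `e` and `U_q` picks up the factor `z^{±1}`, then `∫ G · f(U_q) dν = ∫ G dν · ∫ f dHaar_{U(1)}`
  (average the translate over `z`, Fubini, translation/inversion invariance on the circle).
* Circle moments: `∫ Re z = 0`, `∫ (Re z)² = 1/2`, `∫ (Re z)³ = 0`, `∫ (Re z)⁴ = 3/8`,
  `∫ Re z · z = 1/2`, `∫ Re z · z⁻¹ = 1/2` (angles + Mathlib's `∫ cosⁿ`).
Elementary; nothing is cited as a fact; two `def`s (`holT`, `cosT`), no `sorry`.
-/

noncomputable section

open MeasureTheory Filter Topology Finset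
open Literature.MathematicalPhysics.QuantumFieldTheory
open Literature.MathematicalPhysics.QuantumLattice (u1Rep)
open Literature.MathematicalPhysics.QuantumFieldTheory.CircleHaar (integral_haarProbability_circle)
open Summit.Ventures.LatticeQCDFlow.Theory2.Lattice (U1.re_coe_exp)

namespace Summit.Ventures.LatticeQCDFlow.Theory2.Lattice.U1Torus

variable {d L : ℕ}

/-! ## §1. Torus plaquette holonomies of `U(1)` and one-bond translations -/

/-- The torus plaquette holonomy of the label `q = (x, k, l)`, read on `ℤ^d`-configurations through
the section `torusSigma L`: `U_q = U(x,k) U(x+e_k,l) U(x+e_l,k)⁻¹ U(x,l)⁻¹`. [folklore] -/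
def holT (L : ℕ) (q : TPlaq d L) (U : ZdGaugeConfig d Circle) : Circle :=
  plaquetteHolonomy (torusSigma L U) q.1 q.2.1 q.2.2

/-- The `U(1)` plaquette cosine `Re U_q`. [folklore] -/
def cosT (L : ℕ) (q : TPlaq d L) (U : ZdGaugeConfig d Circle) : ℝ := ((holT L q U : Circle) : ℂ).re

/-- The cost of the torus system for the defining representation of `U(1)` is `1 − Re U_q`. [folklore] -/
theorem torusCost_u1Rep_eq (L : ℕ) (q : TPlaq d L) (U : ZdGaugeConfig d Circle) :
    torusCost u1Rep L q U = 1 - cosT L q U := by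
  simp [torusCost, cosT, holT]

/-- `|Re U_q| ≤ 1`. [folklore] -/
theorem abs_cosT_le_one (L : ℕ) (q : TPlaq d L) (U : ZdGaugeConfig d Circle) : |cosT L q U| ≤ 1 :=
  (Complex.abs_re_le_norm _).trans (le_of_eq (Circle.norm_coe _))

/-- The holonomy is a continuous function of the configuration. [folklore] -/
theorem continuous_holT (L : ℕ) (q : TPlaq d L) : Continuous (holT (d := d) L q) := by
  unfold holT plaquetteHolonomy
  simp only [torusSigma_apply]
  fun_prop

/-- The plaquette cosine is continuous. [folklore] -/
theorem continuous_cosT (L : ℕ) (q : TPlaq d L) : Continuous (cosT (d := d) L q) :=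
  Complex.continuous_re.comp (continuous_subtype_val.comp (continuous_holT L q))

/-- The plaquette cosine is measurable. [folklore] -/
theorem measurable_cosT (L : ℕ) (q : TPlaq d L) : Measurable (cosT (d := d) L q) :=
  (continuous_cosT L q).measurable

/-- Translating the bond variable `e` by `z` translates the torus configuration at the torus bond
whose section is `e` (if any). [folklore] -/
theorem torusSigma_mulSingle (e : ZdEdge d) (z : Circle) (U : ZdGaugeConfig d Circle) (b : Edge d L) :
    torusSigma L (Pi.mulSingle e z * U) b = (if torusSect L b = e then z else 1) * torusSigma L U b := by
  simp only [torusSigma_apply, Pi.mul_apply, Pi.mulSingle_apply]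

/-- A bond variable off the four bonds of `q` does not enter `U_q`. [folklore] -/
theorem holT_mulSingle_of_forall_ne {e : ZdEdge d} {q : TPlaq d L}
    (h1 : torusSect L (q.1, q.2.1) ≠ e) (h2 : torusSect L (q.1.shift q.2.1, q.2.2) ≠ e)
    (h3 : torusSect L (q.1.shift q.2.2, q.2.1) ≠ e) (h4 : torusSect L (q.1, q.2.2) ≠ e)
    (z : Circle) (U : ZdGaugeConfig d Circle) :
    holT L q (Pi.mulSingle e z * U) = holT L q U := by
  simp only [holT, plaquetteHolonomy, torusSigma_mulSingle, h1, h2, h3, h4, if_false, one_mul]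

/-- Translating the FIRST bond `(x,k)` of `q = (x,k,l)` multiplies `U_q` by `z` (the other three
bonds being different torus bonds). [folklore] -/
theorem holT_mulSingle_eq_mul_of_fst {q : TPlaq d L}
    (h2 : (q.1.shift q.2.1, q.2.2) ≠ (q.1, q.2.1)) (h3 : (q.1.shift q.2.2, q.2.1) ≠ (q.1, q.2.1))
    (h4 : (q.1, q.2.2) ≠ (q.1, q.2.1)) (z : Circle) (U : ZdGaugeConfig d Circle) [NeZero L] :
    holT L q (Pi.mulSingle (torusSect L (q.1, q.2.1)) z * U) = z * holT L q U := by
  have i2 : torusSect L (q.1.shift q.2.1, q.2.2) ≠ torusSect L (q.1, q.2.1) :=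
    fun h => h2 (torusSect_injective h)
  have i3 : torusSect L (q.1.shift q.2.2, q.2.1) ≠ torusSect L (q.1, q.2.1) :=
    fun h => h3 (torusSect_injective h)
  have i4 : torusSect L (q.1, q.2.2) ≠ torusSect L (q.1, q.2.1) :=
    fun h => h4 (torusSect_injective h)
  simp only [holT, plaquetteHolonomy, torusSigma_mulSingle, i2, i3, i4, if_true, if_false, one_mul]
  simp only [mul_assoc]

/-- Translating the SECOND bond `(x+e_k,l)` multiplies `U_q` by `z`. [folklore] -/
theorem holT_mulSingle_eq_mul_of_snd {q : TPlaq d L}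
    (h1 : (q.1, q.2.1) ≠ (q.1.shift q.2.1, q.2.2)) (h3 : (q.1.shift q.2.2, q.2.1) ≠ (q.1.shift q.2.1, q.2.2))
    (h4 : (q.1, q.2.2) ≠ (q.1.shift q.2.1, q.2.2)) (z : Circle) (U : ZdGaugeConfig d Circle) [NeZero L] :
    holT L q (Pi.mulSingle (torusSect L (q.1.shift q.2.1, q.2.2)) z * U) = z * holT L q U := by
  have i1 : torusSect L (q.1, q.2.1) ≠ torusSect L (q.1.shift q.2.1, q.2.2) :=
    fun h => h1 (torusSect_injective h)
  have i3 : torusSect L (q.1.shift q.2.2, q.2.1) ≠ torusSect L (q.1.shift q.2.1, q.2.2) :=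
    fun h => h3 (torusSect_injective h)
  have i4 : torusSect L (q.1, q.2.2) ≠ torusSect L (q.1.shift q.2.1, q.2.2) :=
    fun h => h4 (torusSect_injective h)
  simp only [holT, plaquetteHolonomy, torusSigma_mulSingle, i1, i3, i4, if_true, if_false, one_mul]
  simp only [mul_assoc, mul_left_comm _ z]

/-- Translating the THIRD bond `(x+e_l,k)` multiplies `U_q` by `z⁻¹`. [folklore] -/
theorem holT_mulSingle_eq_inv_mul_of_thd {q : TPlaq d L}
    (h1 : (q.1, q.2.1) ≠ (q.1.shift q.2.2, q.2.1)) (h2 : (q.1.shift q.2.1, q.2.2) ≠ (q.1.shift q.2.2, q.2.1))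
    (h4 : (q.1, q.2.2) ≠ (q.1.shift q.2.2, q.2.1)) (z : Circle) (U : ZdGaugeConfig d Circle) [NeZero L] :
    holT L q (Pi.mulSingle (torusSect L (q.1.shift q.2.2, q.2.1)) z * U) = z⁻¹ * holT L q U := by
  have i1 : torusSect L (q.1, q.2.1) ≠ torusSect L (q.1.shift q.2.2, q.2.1) :=
    fun h => h1 (torusSect_injective h)
  have i2 : torusSect L (q.1.shift q.2.1, q.2.2) ≠ torusSect L (q.1.shift q.2.2, q.2.1) :=
    fun h => h2 (torusSect_injective h)
  have i4 : torusSect L (q.1, q.2.2) ≠ torusSect L (q.1.shift q.2.2, q.2.1) :=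
    fun h => h4 (torusSect_injective h)
  simp only [holT, plaquetteHolonomy, torusSigma_mulSingle, i1, i2, i4, if_true, if_false, one_mul]
  simp only [mul_inv, mul_assoc, mul_left_comm _ z⁻¹]

/-- Translating the FOURTH bond `(x,l)` multiplies `U_q` by `z⁻¹`. [folklore] -/
theorem holT_mulSingle_eq_inv_mul_of_fth {q : TPlaq d L}
    (h1 : (q.1, q.2.1) ≠ (q.1, q.2.2)) (h2 : (q.1.shift q.2.1, q.2.2) ≠ (q.1, q.2.2))
    (h3 : (q.1.shift q.2.2, q.2.1) ≠ (q.1, q.2.2)) (z : Circle) (U : ZdGaugeConfig d Circle) [NeZero L] :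
    holT L q (Pi.mulSingle (torusSect L (q.1, q.2.2)) z * U) = z⁻¹ * holT L q U := by
  have i1 : torusSect L (q.1, q.2.1) ≠ torusSect L (q.1, q.2.2) :=
    fun h => h1 (torusSect_injective h)
  have i2 : torusSect L (q.1.shift q.2.1, q.2.2) ≠ torusSect L (q.1, q.2.2) :=
    fun h => h2 (torusSect_injective h)
  have i3 : torusSect L (q.1.shift q.2.2, q.2.1) ≠ torusSect L (q.1, q.2.2) :=
    fun h => h3 (torusSect_injective h)
  simp only [holT, plaquetteHolonomy, torusSigma_mulSingle, i1, i2, i3, if_true, if_false, one_mul]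
  simp only [mul_inv, mul_assoc, mul_left_comm _ z⁻¹]

/-! ## §2. Invariance and peeling -/

/-- **Left invariance of the Haar product under a one-bond translation.** [folklore] -/
theorem integral_mulSingle_mul_eq {E : Type*} [NormedAddCommGroup E] [NormedSpace ℝ E]
    (e : ZdEdge d) (z : Circle) (F : ZdGaugeConfig d Circle → E) :
    ∫ U, F (Pi.mulSingle e z * U) ∂(zdHaar d Circle) = ∫ U, F U ∂(zdHaar d Circle) :=
  integral_mul_left_eq_self F (Pi.mulSingle e z)

/-- Translation and inversion invariance of the Haar probability measure of `U(1)` in the form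
used for peeling: `∫ f(z^{ε} w) dz = ∫ f dz` for `ε = ±1`. [folklore] -/
theorem integral_comp_zpow_mul_eq {E : Type*} [NormedAddCommGroup E] [NormedSpace ℝ E]
    (f : Circle → E) (w : Circle) {ε : ℤ} (hε : ε = 1 ∨ ε = -1) :
    ∫ z, f (z ^ ε * w) ∂(haarProbability Circle) = ∫ z, f z ∂(haarProbability Circle) := by
  rcases hε with rfl | rfl
  · simp only [zpow_one]
    exact integral_mul_right_eq_self f w
  · simp only [zpow_neg, zpow_one]
    have h1 : ∫ z, f (z⁻¹ * w) ∂(haarProbability Circle) =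
        ∫ z, f (z * w) ∂(haarProbability Circle) :=
      integral_inv_eq_self (μ := haarProbability Circle) fun z => f (z * w)
    rw [h1]
    exact integral_mul_right_eq_self f w

/-- **PEELING A PLAQUETTE THROUGH A PRIVATE BOND.**  Let the bond variable `e` multiply `U_q` by
`z^{ε}`, `ε = ±1`, and leave the bounded measurable weight `G` unchanged.  Then for every
continuous `f` on the circle, `∫ G · f(U_q) dν = (∫ G dν) · ∫ f dHaar_{U(1)}`: averaging the
`z`-translate (left invariance of `ν`) over `z` and exchanging the integrals (Fubini), the inner
`z`-integral is `∫ f(z^{ε} U_q) dz = ∫ f dz` by invariance on the circle. [folklore] -/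
theorem integral_mul_comp_holT_eq_mul_integral [NeZero L] {𝕜 : Type*} [RCLike 𝕜] (q : TPlaq d L)
    (e : ZdEdge d) {ε : ℤ} (hε : ε = 1 ∨ ε = -1)
    (hhol : ∀ z U, holT L q (Pi.mulSingle e z * U) = z ^ ε * holT L q U)
    {G : ZdGaugeConfig d Circle → 𝕜} (hGm : Measurable G) {K : ℝ} (hGb : ∀ U, ‖G U‖ ≤ K)
    (hGinv : ∀ z U, G (Pi.mulSingle e z * U) = G U) {f : Circle → 𝕜} (hf : Continuous f) :
    ∫ U, G U * f (holT L q U) ∂(zdHaar d Circle) =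
      (∫ U, G U ∂(zdHaar d Circle)) * ∫ z, f z ∂(haarProbability Circle) := by
  set ν := zdHaar d Circle with hν
  set μ := haarProbability Circle with hμ
  obtain ⟨Kf, hKf⟩ := isCompact_univ.exists_bound_of_continuousOn (f := f) hf.continuousOn
  have hKf' : ∀ z, ‖f z‖ ≤ Kf := fun z => hKf z (Set.mem_univ _)
  have hK0 : 0 ≤ K := (norm_nonneg _).trans (hGb 1)
  -- the two-variable integrand and its integrability on the product
  set Φ : Circle → ZdGaugeConfig d Circle → 𝕜 := fun z U => G U * f (z ^ ε * holT L q U) with hΦ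
  have hΦm : Measurable (Function.uncurry Φ) := by
    refine (hGm.comp measurable_snd).mul (hf.measurable.comp ?_)
    exact ((continuous_zpow ε).comp continuous_fst).mul
      ((continuous_holT L q).comp continuous_snd) |>.measurable
  have hΦb : ∀ p : Circle × ZdGaugeConfig d Circle, ‖Function.uncurry Φ p‖ ≤ K * Kf := by
    rintro ⟨z, U⟩
    simp only [Function.uncurry_apply_pair, hΦ, norm_mul]
    exact mul_le_mul (hGb U) (hKf' _) (norm_nonneg _) hK0
  have hint : Integrable (Function.uncurry Φ) (μ.prod ν) :=
    Integrable.of_bound hΦm.aestronglyMeasurable (K * Kf) (Eventually.of_forall hΦb)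
  -- (1) each translate has the same integral
  have h1 : ∀ z, ∫ U, Φ z U ∂ν = ∫ U, G U * f (holT L q U) ∂ν := by
    intro z
    have := integral_mulSingle_mul_eq e z (fun U => G U * f (holT L q U))
    rw [← this]
    refine integral_congr_ae (Eventually.of_forall fun U => ?_)
    simp only [hΦ, hGinv z U, hhol z U]
  -- (2) the inner `z`-integral is constant in `U`
  have h2 : ∀ U, ∫ z, Φ z U ∂μ = G U * ∫ z, f z ∂μ := by
    intro U
    simp only [hΦ]
    rw [integral_const_mul, integral_comp_zpow_mul_eq f (holT L q U) hε]
  -- (3) Fubini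
  calc ∫ U, G U * f (holT L q U) ∂ν = ∫ z, ∫ U, Φ z U ∂ν ∂μ := by
        simp only [h1, integral_const, probReal_univ, one_smul]
    _ = ∫ U, ∫ z, Φ z U ∂μ ∂ν := integral_integral_swap hint
    _ = ∫ U, G U * ∫ z, f z ∂μ ∂ν := integral_congr_ae (Eventually.of_forall h2)
    _ = (∫ U, G U ∂ν) * ∫ z, f z ∂μ := integral_mul_const _ _

/-! ## §3. Circle moments -/

/-- Haar integrals of powers of `Re z` are normalised integrals of `cosⁿ` over a period. [folklore] -/
theorem integral_re_pow_eq (n : ℕ) :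
    ∫ z, ((z : ℂ).re) ^ n ∂(haarProbability Circle) =
      (2 * Real.pi)⁻¹ * ∫ θ in (-Real.pi)..Real.pi, Real.cos θ ^ n := by
  have hg : Continuous fun z : Circle => ((z : ℂ).re) ^ n :=
    (Complex.continuous_re.comp continuous_subtype_val).pow n
  rw [integral_haarProbability_circle _ hg.aestronglyMeasurable, smul_eq_mul,
    intervalIntegral.integral_of_le (by linarith [Real.pi_pos])]
  simp only [U1.re_coe_exp]

/-- `∫ Re z dHaar = 0`. [folklore] -/
theorem integral_re : ∫ z, (z : ℂ).re ∂(haarProbability Circle) = 0 := by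
  have h := integral_re_pow_eq 1
  simp only [pow_one] at h
  rw [h, integral_cos]
  simp

/-- `∫ (Re z)² dHaar = 1/2`. [folklore] -/
theorem integral_re_sq : ∫ z, ((z : ℂ).re) ^ 2 ∂(haarProbability Circle) = 1 / 2 := by
  rw [integral_re_pow_eq 2, integral_cos_sq]
  have hπ : Real.pi ≠ 0 := Real.pi_ne_zero
  simp only [Real.sin_pi, Real.sin_neg, mul_zero, neg_zero, sub_zero, zero_add, sub_neg_eq_add]
  field_simp
  ring

/-- `∫ (Re z)³ dHaar = 0`. [folklore] -/
theorem integral_re_cube : ∫ z, ((z : ℂ).re) ^ 3 ∂(haarProbability Circle) = 0 := by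
  rw [integral_re_pow_eq 3, integral_cos_pow_three]
  simp

/-- `∫ (Re z)⁴ dHaar = 3/8`. [folklore] -/
theorem integral_re_four : ∫ z, ((z : ℂ).re) ^ 4 ∂(haarProbability Circle) = 3 / 8 := by
  rw [integral_re_pow_eq 4]
  have h4 := @integral_cos_pow (-Real.pi) Real.pi 2
  rw [h4, integral_cos_sq]
  have hπ : Real.pi ≠ 0 := Real.pi_ne_zero
  simp only [Real.sin_pi, Real.sin_neg, Real.cos_neg, Real.cos_pi, mul_zero, neg_zero, sub_zero,
    zero_add, sub_neg_eq_add]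
  norm_num
  field_simp
  ring

/-- `∫ Re z · z dHaar = 1/2` (complex valued). [folklore] -/
theorem integral_re_mul_self : ∫ z, ((z : ℂ).re : ℂ) * (z : ℂ) ∂(haarProbability Circle) = 1 / 2 := by
  have hg : Continuous fun z : Circle => ((z : ℂ).re : ℂ) * (z : ℂ) :=
    (Complex.continuous_ofReal.comp (Complex.continuous_re.comp continuous_subtype_val)).mul
      continuous_subtype_val
  rw [integral_haarProbability_circle _ hg.aestronglyMeasurable,
    ← intervalIntegral.integral_of_le (by linarith [Real.pi_pos])]
  simp only [Circle.coe_exp]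
  -- `cos θ · e^{iθ} = cos²θ + i cos θ sin θ`
  have hsplit : ∀ θ : ℝ, (((Complex.exp (θ * Complex.I)).re : ℝ) : ℂ) * Complex.exp (θ * Complex.I) =
      ((Real.cos θ ^ 2 : ℝ) : ℂ) + ((Real.sin θ * Real.cos θ : ℝ) : ℂ) * Complex.I := by
    intro θ
    rw [Complex.exp_ofReal_mul_I_re, Complex.exp_mul_I, ← Complex.ofReal_cos, ← Complex.ofReal_sin]
    push_cast
    ring
  simp_rw [hsplit]
  rw [intervalIntegral.integral_add, intervalIntegral.integral_mul_const,
    intervalIntegral.integral_ofReal, intervalIntegral.integral_ofReal, integral_cos_sq,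
    integral_sin_mul_cos₁]
  · have hπ : (Real.pi : ℂ) ≠ 0 := Complex.ofReal_ne_zero.2 Real.pi_ne_zero
    simp only [Real.sin_pi, Real.sin_neg, Real.cos_neg, Real.cos_pi, mul_zero, neg_zero, sub_zero,
      zero_add, sub_neg_eq_add]
    rw [Complex.real_smul]
    push_cast
    field_simp
    ring
  · exact (Complex.continuous_ofReal.comp ((Real.continuous_cos).pow 2)).intervalIntegrable _ _
  · exact ((Complex.continuous_ofReal.comp (Real.continuous_sin.mul Real.continuous_cos)).mul
      continuous_const).intervalIntegrable _ _

/-- `∫ Re z · z⁻¹ dHaar = 1/2` (inversion invariance of the Haar measure). [folklore] -/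
theorem integral_re_mul_inv : ∫ z, ((z : ℂ).re : ℂ) * (z : ℂ)⁻¹ ∂(haarProbability Circle) = 1 / 2 := by
  have h := integral_inv_eq_self (μ := haarProbability Circle)
    fun z : Circle => ((z : ℂ).re : ℂ) * (z : ℂ)
  rw [← integral_re_mul_self, ← h]
  refine integral_congr_ae (Eventually.of_forall fun z => ?_)
  simp only [Circle.coe_inv]
  congr 2
  rw [Complex.inv_re, Complex.normSq_eq_norm_sq, Circle.norm_coe]
  simp

end Summit.Ventures.LatticeQCDFlow.Theory2.Lattice.U1Torus

end
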